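import Literature.Barriers.CriticalPhenomena.KozmaNachmiasVolumeTail
import Literature.Probability.Percolation.TriangleSusceptibilityDerivative

/-!
# Discharge of named literature fact(s) by composition

This file only composes reductions and discharges that are already in the tree
(no new definitions, no new named facts): each `theorem X_holds : X` below feeds the
proved hypotheses into an existing reduction theorem.  Net effect: the listed facts
stop being literature debt.
-/

namespace Literature.Barriers.CriticalPhenomena

/-- Discharge of `KozmaNachmias2011_volumeTail` from the proved Aizenman–Newman mean-field
exponent `γ = 1` (`AizenmanNewman1984_gamma_eq_one_holds`) via
`KozmaNachmias2011_volumeTail_of_gamma`.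
[cite: KozmaNachmias2011, (1.1) and §1.1 (p. 377)] -/
theorem KozmaNachmias2011_volumeTail_holds : KozmaNachmias2011_volumeTail :=
  KozmaNachmias2011_volumeTail_of_gamma
    Literature.Probability.Percolation.AizenmanNewman1984_gamma_eq_one_holds

end Literature.Barriers.CriticalPhenomena
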